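import Literature.Computability.AlgebraicComplexity.GCTObstructions
import Literature.Computability.AlgebraicComplexity.Hyperdeterminant
import Literature.NumberTheory.DiophantineGeometry.GLTensorSemisimpleProofs
import Literature.NumberTheory.DiophantineGeometry.SchurWeylPlethysmOrbitWeightsProofs
import HarnessLib

/-!
# Full polarisation of forms on `Sym^m V^*` and the BLMW lift `k[Δ_m[f]] ⇝ k[Sym^m V]`

Topic `Literature/Computability/AlgebraicComplexity`, in the G20/H21 orbit-closure conventions of
`OrbitCoordinateRing.lean` (`coordRep σ k m` is the representation of `GL(k^σ)` on
`k[Sym^m (k^σ)] = k[X_e : |e| = m]` by `coordSubst m g` (`(g · F)(v) = F(g⁻¹ v)`), `orbitCoordRep f m`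
the induced representation on `k[Δ_m[f]] = k[Sym^m]/I`, `I = orbitVanishingIdeal f m`; highest
weights for the upper triangular Borel, `GLHighestWeight.lean`).

This file DISCHARGES the named fact `hasHighestWeight_coordRep_of_orbitCoordRep` of
`SchurWeylPlethysm.lean` (BLMW 2011 §5.2; BIP 2019 §1(a)): in characteristic zero every highest
weight `χ` occurring in `k[Δ_m[f]]` (`m ≠ 0`) occurs in `k[Sym^m (k^σ)]` — in the sources a
one-line consequence of "`k[Δ[f]]_d` is a quotient of the completely reducible `GL`-module
`k[Sym^m V]_d`". The tree proves complete reducibility for the tensor powers `(k^σ)^{⊗n}`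
(`isSemisimpleRepresentation_glTensorRep`, Schur–Weyl double centraliser,
`GLTensorSemisimpleProofs.lean`) but not for `k[Sym^m]_D = Sym^D (Sym^m V)^*`; we transport it along
the **full polarisation** (BIP §3(a): forms as symmetric tensors; §4, (4.1): `Sym^d Sym^n V` is the
space of `S_d ≀ S_n`-invariants in `⊗^{dn} V`)

  `Φ : k[Sym^m (k^σ)]_D → {functions on nested words u : Fin D → Fin m → σ}`,
  `Φ(F)(u) = arrOf D F (r ↦ content of the inner word u r)`

(`polarize`; `arrOf` is the symmetric `D`-array of a form in the letters `X_e`,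
`Hyperdeterminant.lean`, and the content `wordExp w` of a word `w : Fin m → σ` is its exponent
vector), and prove that `Φ` is
* injective on forms of degree `D` (`eq_of_polarize_eq`: a form is the symmetrisation of its array,
  `sum_arrOf_mul_prod_X`, and every exponent of degree `m` is a content, `exists_wordExp_eq`);
* equivariant (`polarize_coordSubst`): `Φ(g · F)(u) = ∑_v (∏_{r,p} (g⁻¹)_{v r p, u r p}) Φ(F)(v)`,
  from the matrix of `g⁻¹ ·` on `Sym^m V^*` in the monomial basis written as a sum over words
  (`coeff_linSubst_monomial_eq_sum_words`) and the transformation law of arrays (`arrOf_linSubst`).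
The kernel action `nestedAct` on functions on nested words becomes, after flattening
`Fin D × Fin m ≃ Fin (D·m)` (`flattenFun_nestedAct`), the word-model form `wordAct` of `glTensorRep`
(`wordFunEquiv_wordAct`, coordinates `tensorBasis_repr_glTensorRep`) for the transpose-inverse
`g⁻ᵀ` (`transposeInv`), so subspaces stable under all `nestedAct g` have stable complements
(`exists_isCompl_of_wordAct_stable`, `exists_isCompl_of_nestedAct_stable`).

The lift (`hasHighestWeight_coordRep_of_orbitCoordRep_holds`). A nonzero semi-invariant class of
weight `χ` in `k[Sym^m]/I` lifts to `F ∉ I` with `b · F - χ(b) F ∈ I` for all upper triangular `b`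
(`exists_lift_of_hasHighestWeight_orbitCoordRep`, `OrbitClosureWeights.lean`); its part `P` of torus
weight `χ` is a form of degree `D = |χ|/m`, still `∉ I` and semi-invariant modulo `I`
(`exists_semiInvariant_mod_orbitVanishingIdeal`; the other weight parts of `F` lie in `I`,
`sum_filter_monWeight_mem_orbitVanishingIdeal`, and a torus weight pins the degree, BLMW §4.4).
With `Y` a stable complement of `Φ(I ∩ k[Sym^m]_D)`
(`exists_isCompl_map_polarizeLin_orbitVanishingIdeal`) write `Φ(P) = Φ(A) + y` with
`A ∈ I ∩ k[Sym^m]_D`, `y ∈ Y`. Then `P - A ∉ I` and, for upper triangular `b`,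
`G = b · (P - A) - χ(b) (P - A)` lies in `I ∩ k[Sym^m]_D` while `Φ(G) = b ⋆ y - χ(b) y ∈ Y`; so
`Φ(G) = 0`, `G = 0`, and `P - A` is an honest highest-weight vector of weight `χ`
(`hasHighestWeight_coordRep_of_semiInvariant_mod`).

`CharZero k` enters through Schur–Weyl semisimplicity and through the division by the multinomial
fibre sizes in `arrOf`; nothing is specific to `k = ℂ` or to `σ = MatIdx m`.

## References

* P. Bürgisser, J.M. Landsberg, L. Manivel, J. Weyman, *An overview of mathematical issues arising
  in the geometric complexity theory approach to VP ≠ VNP*, SIAM J. Comput. 40 (2011), §4.4, §5.2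
  and (5.2.2) (key `BurgisserEtAl2011`).
* P. Bürgisser, C. Ikenmeyer, G. Panova, *No occurrence obstructions in geometric complexity
  theory*, J. AMS 32 (2019) = arXiv:1604.06431v3, §1(a), §3(a) (polarisation), §4, (4.1)
  (`Sym^d Sym^n V` as `S_d ≀ S_n`-invariants in `⊗^{dn} V`) (key `BurgisserIkenmeyerPanovaJAMS2019`).
* P. Etingof et al., *Introduction to representation theory*, Student Math. Library 59, AMS (2011)
  = arXiv:0901.0827, Thm. 4.57 (ii) and Prop. 4.58 (Schur–Weyl; key `EtingofEtAl2011`).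
* W. Fulton, *Young Tableaux*, LMS Student Texts 35 (1997), §8.1 (coordinates of the diagonal
  action on `V^{⊗n}`; key `FultonYoungTableaux1997`).
-/

open MvPolynomial
open scoped TensorProduct

namespace Literature.Computability.AlgebraicComplexity

/-! ### The word model of `(k^σ)^{⊗n}` and invariant complements -/

section WordModel

variable {k : Type*} [Field k] {σ : Type*} [Fintype σ] [DecidableEq σ] {n : ℕ}

/-- Coordinates of the diagonal `GL`-action on `(k^σ)^{⊗n}` in the standard basis (general index
type; `repr_glTensorRep` is the case `σ = Fin N`): `(g · v)_J = ∑_I (∏_i g_{J i, I i}) v_I`, by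
linearity from `tensorBasis_repr_glTensorRep_tensorBasis`. Fulton, *Young Tableaux*, §8.1.
[folklore] -/
theorem tensorBasis_repr_glTensorRep (g : GL σ k) (v : TensorPower k n (σ → k)) (J : Fin n → σ) :
    (Literature.NumberTheory.DiophantineGeometry.tensorBasis k σ n).repr (Literature.NumberTheory.DiophantineGeometry.glTensorRep σ k n g v) J =
      ∑ I : Fin n → σ, (∏ i, (g : Matrix σ σ k) (J i) (I i)) * (Literature.NumberTheory.DiophantineGeometry.tensorBasis k σ n).repr v I := by
  classical
  -- both sides are linear in `v`; check on the basis
  have key : ∀ I₀ : Fin n → σ, (Literature.NumberTheory.DiophantineGeometry.tensorBasis k σ n).repr (Literature.NumberTheory.DiophantineGeometry.glTensorRep σ k n g (Literature.NumberTheory.DiophantineGeometry.tensorBasis k σ n I₀)) J =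
      ∏ i, (g : Matrix σ σ k) (J i) (I₀ i) := fun I₀ => Literature.NumberTheory.DiophantineGeometry.tensorBasis_repr_glTensorRep_tensorBasis g I₀ J
  conv_lhs => rw [← (Literature.NumberTheory.DiophantineGeometry.tensorBasis k σ n).linearCombination_repr v, Finsupp.linearCombination_apply,
    Finsupp.sum, map_sum, map_sum]
  rw [Finset.sum_apply']
  simp only [map_smul, Finsupp.smul_apply, smul_eq_mul, key]
  rw [← Finset.sum_subset (Finset.subset_univ ((Literature.NumberTheory.DiophantineGeometry.tensorBasis k σ n).repr v).support) fun I _ hI => by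
    rw [Finsupp.notMem_support_iff.mp hI, mul_zero]]
  refine Finset.sum_congr rfl fun I _ => ?_
  rw [mul_comm]

/-- The word model: functions on words, identified with `(k^σ)^{⊗n}` by the standard basis.
[folklore] -/
noncomputable def wordFunEquiv (σ k : Type*) [Field k] [Fintype σ] [DecidableEq σ] (n : ℕ) :
    ((Fin n → σ) → k) ≃ₗ[k] TensorPower k n (σ → k) :=
  (Finsupp.linearEquivFunOnFinite k k (Fin n → σ)).symm ≪≫ₗ (Literature.NumberTheory.DiophantineGeometry.tensorBasis k σ n).repr.symm

/-- Coordinates of `wordFunEquiv c` are `c`. [folklore] -/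
theorem tensorBasis_repr_wordFunEquiv (c : (Fin n → σ) → k) (I : Fin n → σ) :
    (Literature.NumberTheory.DiophantineGeometry.tensorBasis k σ n).repr (wordFunEquiv σ k n c) I = c I := by
  simp [wordFunEquiv]

/-- The diagonal `GL`-action in the word model: `(g ⋆ c)(J) = ∑_I (∏_i g_{J i, I i}) c(I)`.
[folklore] -/
noncomputable def wordAct (g : GL σ k) (c : (Fin n → σ) → k) : (Fin n → σ) → k :=
  fun J => ∑ I : Fin n → σ, (∏ i, (g : Matrix σ σ k) (J i) (I i)) * c I

/-- `wordFunEquiv` intertwines `wordAct` with `glTensorRep`. [folklore] -/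
theorem wordFunEquiv_wordAct (g : GL σ k) (c : (Fin n → σ) → k) :
    wordFunEquiv σ k n (wordAct g c) = Literature.NumberTheory.DiophantineGeometry.glTensorRep σ k n g (wordFunEquiv σ k n c) := by
  apply (Literature.NumberTheory.DiophantineGeometry.tensorBasis k σ n).repr.injective
  ext J
  rw [tensorBasis_repr_wordFunEquiv, tensorBasis_repr_glTensorRep]
  simp only [tensorBasis_repr_wordFunEquiv]
  rfl

/-- **Invariant complements in the word model** (Schur–Weyl semisimplicity of `(k^σ)^{⊗n}` in
characteristic zero, `isSemisimpleRepresentation_glTensorRep`, transported along `wordFunEquiv`):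
every subspace of functions on words stable under all `wordAct g` has a stable complement.
[cite: EtingofEtAl2011, Thm. 4.57 (ii) and Prop. 4.58 (arXiv:0901.0827 numbering)] -/
theorem exists_isCompl_of_wordAct_stable [CharZero k] (X : Submodule k ((Fin n → σ) → k))
    (hX : ∀ (g : GL σ k) (c : (Fin n → σ) → k), c ∈ X → wordAct g c ∈ X) :
    ∃ Y : Submodule k ((Fin n → σ) → k), (∀ (g : GL σ k) (c : (Fin n → σ) → k), c ∈ Y → wordAct g c ∈ Y)
      ∧ IsCompl X Y := by
  set e := wordFunEquiv σ k n with he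
  -- `X` as a subrepresentation of the tensor power
  let X' : Subrepresentation (Literature.NumberTheory.DiophantineGeometry.glTensorRep σ k n) :=
    { toSubmodule := X.map e.toLinearMap
      apply_mem_toSubmodule := fun g v hv => by
        obtain ⟨c, hc, rfl⟩ := Submodule.mem_map.mp hv
        exact Submodule.mem_map.mpr ⟨wordAct g c, hX g c hc, wordFunEquiv_wordAct g c⟩ }
  obtain ⟨Y', hY'⟩ := (Literature.NumberTheory.DiophantineGeometry.isSemisimpleRepresentation_glTensorRep (σ := σ) (k := k) n).exists_isCompl X'
  refine ⟨Y'.toSubmodule.comap e.toLinearMap, fun g c hc => ?_, ?_⟩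
  · rw [Submodule.mem_comap] at hc ⊢
    change e (wordAct g c) ∈ Y'.toSubmodule
    rw [wordFunEquiv_wordAct]
    exact Y'.apply_mem_toSubmodule g hc
  · -- transport `IsCompl` back along the linear equivalence
    have h1 : IsCompl X'.toSubmodule Y'.toSubmodule := by
      constructor
      · rw [disjoint_iff]
        have := hY'.1
        rw [disjoint_iff] at this
        exact congrArg Subrepresentation.toSubmodule this
      · rw [codisjoint_iff]
        have := hY'.2
        rw [codisjoint_iff] at this
        exact congrArg Subrepresentation.toSubmodule this
    have h2 := (Submodule.orderIsoMapComap e.symm).isCompl h1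
    -- `orderIsoMapComap e.symm (X.map e) = X` and `orderIsoMapComap e.symm Y'.toSubmodule = comap e Y'`
    have hX : Submodule.orderIsoMapComap e.symm X'.toSubmodule = X := by
      change Submodule.map e.symm.toLinearMap (Submodule.map e.toLinearMap X) = X
      rw [← Submodule.map_comp]
      convert Submodule.map_id X
      ext c; simp
    have hY : Submodule.orderIsoMapComap e.symm Y'.toSubmodule = Y'.toSubmodule.comap e.toLinearMap := by
      change Submodule.map e.symm.toLinearMap Y'.toSubmodule = _
      exact Submodule.map_equiv_eq_comap_symm e.symm Y'.toSubmodule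
    rw [hX, hY] at h2
    exact h2

end WordModel

section Polarization

variable {k : Type*} [Field k] {σ : Type*} [Fintype σ] [DecidableEq σ] {ℓ : ℕ}

/-! ### The matrix of `B ·` on `Sym^ℓ V^*` through words -/

/-- **Coefficients of a substituted monomial as a sum over words.** For a word `u` of content `e`
(`x_u = x^e`) and any `d`, the coefficient of `x^d` in `B · x^e` is the sum over the words `v` of
content `d` of `∏_p B_{v_p, u_p}` (expand `B · x_u = ∏_p (∑_y B_{y u_p} x_y)`). This is the matrix of
`B ·` on `Sym^ℓ V^*` in the monomial basis, written through the tensor power. [folklore] -/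
theorem coeff_linSubst_monomial_eq_sum_words (B : Matrix σ σ k) (u : Fin ℓ → σ) (d : σ →₀ ℕ) :
    coeff d (linSubst σ k B (monomial (∑ p, Finsupp.single (u p) 1) 1)) =
      ∑ v ∈ (Finset.univ : Finset (Fin ℓ → σ)).filter (fun v => (∑ p, Finsupp.single (v p) 1) = d),
        ∏ p, B (v p) (u p) := by
  classical
  have hexp : linSubst σ k B (monomial (∑ p, Finsupp.single (u p) 1) 1) =
      ∑ v : Fin ℓ → σ, (∏ p, B (v p) (u p)) • monomial (∑ p, Finsupp.single (v p) 1) (1 : k) := by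
    rw [monomial_sum_index, C_1, one_mul, map_prod]
    have h1 : ∀ p, linSubst σ k B (monomial (Finsupp.single (u p) 1) 1) = ∑ y, B y (u p) • X y := by
      intro p
      rw [← X_pow_eq_monomial, pow_one, linSubst_X]
    simp only [h1]
    rw [Finset.prod_univ_sum (fun _ => Finset.univ) fun p y => B y (u p) • (X y : MvPolynomial σ k)]
    simp only [Fintype.piFinset_univ]
    refine Finset.sum_congr rfl fun v _ => ?_
    rw [Finset.prod_smul, monomial_sum_index, C_1, one_mul]
    congr 1
  rw [hexp, coeff_sum]
  simp only [coeff_smul, coeff_monomial, smul_eq_mul, mul_ite, mul_one, mul_zero]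
  rw [Finset.sum_filter]

/-! ### The full polarisation `Φ` of `k[Sym^m]_D` into functions on words, and its equivariance -/

section Phi

variable {m D : ℕ}

/-- `coordSubst m g` is the linear substitution of the coordinates `X_d` by the matrix
`(B_g)_{e d} = coeff_d (g⁻¹ · x^e)`. [folklore] -/
theorem coordSubst_eq_linSubst (m : ℕ) (g : GL σ k) :
    coordSubst m g = linSubst (DegIdx σ m) k
      (Matrix.of fun e d : DegIdx σ m => coeff d.1 (linSubstRep σ k g⁻¹ (monomial e.1 (1 : k)))) := by
  refine MvPolynomial.algHom_ext fun d => ?_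
  rw [coordSubst_X, linSubst_X]
  rfl

/-- **The full polarisation** of a polynomial function on `Sym^m V^*` of degree `D`: the function on
words `u : Fin D → Fin m → σ` (i.e. on `(V^*)^{⊗ mD}` in coordinates) given by the symmetric `D`-array
of `F ∈ k[X_e : |e| = m]` (`arrOf D F`) read at the contents of the blocks of `u`. It is injective on
forms of degree `D` (`sum_arrOf_mul_prod_X`) and intertwines `coordRep` with the word action of
`g⁻ᵀ` (`polarize_coordSubst`). BIP §3(a) (forms as symmetric tensors), §4, (4.1)
(`Sym^d Sym^n V ⊆ ⊗^{dn} V`). [folklore] -/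
noncomputable def polarize (m D : ℕ) (F : MvPolynomial (DegIdx σ m) k) (u : Fin D → Fin m → σ) : k :=
  arrOf D F fun r => (⟨wordExp (u r), mem_degMonomials_iff.mpr (degree_wordExp _)⟩ : DegIdx σ m)

/-- **Equivariance of the full polarisation**: for `F` a form of degree `D` on `k[Sym^m]` and `g ∈ GL`,
`Φ(g · F)(u) = ∑_v (∏_{r,p} (g⁻¹)_{v_{r p}, u_{r p}}) Φ(F)(v)` — the action of `g⁻ᵀ` on words of length
`D·m`. [folklore] -/
theorem polarize_coordSubst [CharZero k] (g : GL σ k) {F : MvPolynomial (DegIdx σ m) k}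
    (hF : F.IsHomogeneous D) (u : Fin D → Fin m → σ) :
    polarize m D (coordSubst m g F) u =
      ∑ v : Fin D → Fin m → σ,
        (∏ r, ∏ p, ((g⁻¹ : GL σ k) : Matrix σ σ k) (v r p) (u r p)) * polarize m D F v := by
  classical
  rw [polarize, coordSubst_eq_linSubst, arrOf_linSubst _ hF]
  simp only [Matrix.of_apply, linSubstRep_apply]
  -- expand each kernel entry as a sum over words of the given content
  have hker : ∀ (r : Fin D) (J : Fin D → DegIdx σ m),
      coeff (J r).1 (linSubst σ k ((g⁻¹ : GL σ k) : Matrix σ σ k) (monomial (wordExp (u r)) 1)) =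
        ∑ v ∈ (Finset.univ : Finset (Fin m → σ)).filter (fun v => wordExp v = (J r).1),
          ∏ p, ((g⁻¹ : GL σ k) : Matrix σ σ k) (v p) (u r p) := by
    intro r J
    rw [wordExp, coeff_linSubst_monomial_eq_sum_words]
    rfl
  simp only [hker]
  -- `∏_r ∑_{v_r ∈ fibre(J r)} = ∑_{v : ∀ r, v r ∈ fibre (J r)} ∏_r`
  simp only [Finset.prod_sum, Finset.sum_mul]
  -- regroup the double sum `∑_J ∑_{v ∈ fibres of J}` as a single sum over all `v`
  symm
  rw [← Finset.sum_fiberwise_of_maps_to (s := Finset.univ) (t := Finset.univ)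
    (g := fun v : Fin D → Fin m → σ => fun r =>
      (⟨wordExp (v r), mem_degMonomials_iff.mpr (degree_wordExp _)⟩ : DegIdx σ m))
    (fun v _ => Finset.mem_univ _)]
  refine Finset.sum_congr rfl fun J _ => ?_
  rw [Finset.sum_bij' (fun (v : Fin D → Fin m → σ) _ => fun r (_ : r ∈ (Finset.univ : Finset (Fin D))) => v r)
    (fun (v : ∀ r ∈ (Finset.univ : Finset (Fin D)), Fin m → σ) _ => fun r => v r (Finset.mem_univ r))]
  · intro v hv
    simp only [Finset.mem_filter, Finset.mem_univ, true_and] at hv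
    simp only [Finset.mem_pi, Finset.mem_filter, Finset.mem_univ, true_and]
    intro r _
    exact congrArg Subtype.val (congrFun hv r)
  · intro v hv
    simp only [Finset.mem_pi, Finset.mem_filter, Finset.mem_univ, true_and] at hv
    simp only [Finset.mem_filter, Finset.mem_univ, true_and]
    funext r
    exact Subtype.ext (hv r trivial)
  · intro v _; rfl
  · intro v _; rfl
  · intro v hv
    simp only [Finset.mem_filter, Finset.mem_univ, true_and] at hv
    subst hv
    rw [Finset.prod_attach Finset.univ (fun r => ∏ p, ((g⁻¹ : GL σ k) : Matrix σ σ k) (v r p) (u r p))]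
    rfl

/-- **The full polarisation is injective on forms of degree `D`** (a form is the symmetrisation
of its array, `sum_arrOf_mul_prod_X`, and every degree-`m` letter is the content of a word).
[folklore] -/
theorem eq_of_polarize_eq [CharZero k] {F G : MvPolynomial (DegIdx σ m) k} (hF : F.IsHomogeneous D)
    (hG : G.IsHomogeneous D) (h : polarize m D F = polarize m D G) : F = G := by
  classical
  have harr : arrOf D F = arrOf D G := by
    funext J
    -- each letter of `J` is the content of an inner word
    choose u hu using fun r => exists_wordExp_eq (σ := σ) (J r).1 (mem_degMonomials_iff.mp (J r).2)
    have hJ : J = fun r => (⟨wordExp (u r), mem_degMonomials_iff.mpr (degree_wordExp _)⟩ : DegIdx σ m) :=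
      funext fun r => Subtype.ext (hu r).symm
    have := congrFun h u
    rw [polarize, polarize] at this
    rw [hJ]
    exact this
  rw [← sum_arrOf_mul_prod_X hF, ← sum_arrOf_mul_prod_X hG, harr]

end Phi

/-! ### Invariant complements for functions on nested words -/

section Nested

variable {m D : ℕ}

/-- The transpose-inverse automorphism of `GL`. [folklore] -/
def transposeInv (g : GL σ k) : GL σ k :=
  ⟨((g⁻¹ : GL σ k) : Matrix σ σ k).transpose, ((g : GL σ k) : Matrix σ σ k).transpose,
    by rw [← Matrix.transpose_mul, ← Units.val_mul, mul_inv_cancel, Units.val_one, Matrix.transpose_one],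
    by rw [← Matrix.transpose_mul, ← Units.val_mul, inv_mul_cancel, Units.val_one, Matrix.transpose_one]⟩

/-- The matrix of `transposeInv g` is `(g⁻¹)ᵀ`. [folklore] -/
theorem coe_transposeInv (g : GL σ k) :
    ((transposeInv g : GL σ k) : Matrix σ σ k) = ((g⁻¹ : GL σ k) : Matrix σ σ k).transpose := rfl

/-- `transposeInv` is an involution. [folklore] -/
theorem transposeInv_transposeInv (g : GL σ k) : transposeInv (transposeInv g) = g := by
  apply Units.ext
  change (((transposeInv g)⁻¹ : GL σ k) : Matrix σ σ k).transpose = _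
  rfl

/-- The kernel action of `GL` on functions on nested words `u : Fin D → Fin m → σ`:
`(T_g c)(u) = ∑_v (∏_{r,p} (g⁻¹)_{v r p, u r p}) c(v)`, under which the full polarisation is
equivariant (`polarize_coordSubst`). [folklore] -/
noncomputable def nestedAct (g : GL σ k) (c : (Fin D → Fin m → σ) → k) : (Fin D → Fin m → σ) → k :=
  fun u => ∑ v : Fin D → Fin m → σ, (∏ r, ∏ p, ((g⁻¹ : GL σ k) : Matrix σ σ k) (v r p) (u r p)) * c v

/-- Flattening nested words `Fin D → Fin m → σ` into words of length `D·m`. [folklore] -/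
def flattenWord (D m : ℕ) : (Fin D → Fin m → σ) ≃ (Fin (D * m) → σ) where
  toFun u q := u (finProdFinEquiv.symm q).1 (finProdFinEquiv.symm q).2
  invFun w r p := w (finProdFinEquiv (r, p))
  left_inv u := by funext r p; simp
  right_inv w := by
    funext q
    exact congrArg w (finProdFinEquiv.apply_symm_apply q)

omit [Fintype σ] [DecidableEq σ] in
/-- Unflattening a word: `(unflatten w) r p = w ⟨r, p⟩`. [folklore] -/
theorem flattenWord_symm_apply (w : Fin (D * m) → σ) (r : Fin D) (p : Fin m) :
    (flattenWord D m).symm w r p = w (finProdFinEquiv (r, p)) := rfl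

/-- Flattening at the level of functions on words (a linear equivalence). [folklore] -/
noncomputable def flattenFun (D m : ℕ) : ((Fin D → Fin m → σ) → k) ≃ₗ[k] ((Fin (D * m) → σ) → k) :=
  LinearEquiv.funCongrLeft k k (flattenWord (σ := σ) D m).symm

omit [Fintype σ] [DecidableEq σ] in
/-- `flattenFun c w = c (unflatten w)`. [folklore] -/
theorem flattenFun_apply (c : (Fin D → Fin m → σ) → k) (w : Fin (D * m) → σ) :
    flattenFun D m c w = c ((flattenWord D m).symm w) := rfl

/-- **Flattening intertwines the nested kernel action with the word action of the
transpose-inverse.** [folklore] -/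
theorem flattenFun_nestedAct (g : GL σ k) (c : (Fin D → Fin m → σ) → k) :
    flattenFun D m (nestedAct g c) = wordAct (transposeInv g) (flattenFun D m c) := by
  funext w
  rw [flattenFun_apply, nestedAct, wordAct]
  rw [← Equiv.sum_comp (flattenWord (σ := σ) D m).symm]
  refine Finset.sum_congr rfl fun v _ => ?_
  rw [flattenFun_apply]
  congr 1
  -- the kernels agree after reindexing the product by `finProdFinEquiv`
  rw [← Fintype.prod_prod_type' (f := fun r p =>
    ((g⁻¹ : GL σ k) : Matrix σ σ k) (((flattenWord D m).symm v) r p) (((flattenWord D m).symm w) r p)),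
    ← Equiv.prod_comp finProdFinEquiv.symm]
  refine Finset.prod_congr rfl fun q _ => ?_
  rw [flattenWord_symm_apply, flattenWord_symm_apply, Prod.mk.eta, Equiv.apply_symm_apply,
    coe_transposeInv, Matrix.transpose_apply]

/-- **Invariant complements for functions on nested words**: every subspace stable under all
`nestedAct g` has a stable complement (from `exists_isCompl_of_wordAct_stable` by flattening).
[cite: EtingofEtAl2011, Thm. 4.57 (ii) and Prop. 4.58 (arXiv:0901.0827 numbering)] -/
theorem exists_isCompl_of_nestedAct_stable [CharZero k] (X : Submodule k ((Fin D → Fin m → σ) → k))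
    (hX : ∀ (g : GL σ k) (c : (Fin D → Fin m → σ) → k), c ∈ X → nestedAct g c ∈ X) :
    ∃ Y : Submodule k ((Fin D → Fin m → σ) → k),
      (∀ (g : GL σ k) (c : (Fin D → Fin m → σ) → k), c ∈ Y → nestedAct g c ∈ Y) ∧ IsCompl X Y := by
  set e := flattenFun (σ := σ) (k := k) D m with he
  obtain ⟨Y', hY's, hY'⟩ := exists_isCompl_of_wordAct_stable (X.map e.toLinearMap) (by
    intro h c hc
    obtain ⟨c₀, hc₀, rfl⟩ := Submodule.mem_map.mp hc
    refine Submodule.mem_map.mpr ⟨nestedAct (transposeInv h) c₀, hX _ _ hc₀, ?_⟩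
    change e (nestedAct (transposeInv h) c₀) = wordAct h (e c₀)
    rw [he, flattenFun_nestedAct, transposeInv_transposeInv])
  refine ⟨Y'.comap e.toLinearMap, fun g c hc => ?_, ?_⟩
  · rw [Submodule.mem_comap] at hc ⊢
    change e (nestedAct g c) ∈ Y'
    rw [he, flattenFun_nestedAct]
    exact hY's _ _ hc
  · have h2 := (Submodule.orderIsoMapComap e.symm).isCompl hY'
    have hXe : Submodule.orderIsoMapComap e.symm (X.map e.toLinearMap) = X := by
      change Submodule.map e.symm.toLinearMap (Submodule.map e.toLinearMap X) = X
      rw [← Submodule.map_comp]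
      convert Submodule.map_id X
      ext c; simp
    have hYe : Submodule.orderIsoMapComap e.symm Y' = Y'.comap e.toLinearMap := by
      change Submodule.map e.symm.toLinearMap Y' = _
      exact Submodule.map_equiv_eq_comap_symm e.symm Y'
    rw [hXe, hYe] at h2
    exact h2

end Nested

end Polarization

/-! ### The BLMW lift: occurrence in `k[Δ_m[f]]` implies occurrence in `k[Sym^m]` -/

section Lift

variable {k : Type*} [Field k] {σ : Type*} [Fintype σ] [LinearOrder σ] {m D : ℕ}

/-- The full polarisation as a `k`-linear map. [folklore] -/
noncomputable def polarizeLin (m D : ℕ) :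
    MvPolynomial (DegIdx σ m) k →ₗ[k] ((Fin D → Fin m → σ) → k) where
  toFun := polarize m D
  map_add' F G := by
    funext u
    simp only [polarize, arrOf, Pi.add_apply, coeff_add, add_div]
  map_smul' c F := by
    funext u
    simp only [polarize, arrOf, Pi.smul_apply, coeff_smul, smul_eq_mul, RingHom.id_apply, mul_div_assoc]

/-- `polarizeLin` is `polarize`. [folklore] -/
theorem polarizeLin_apply (F : MvPolynomial (DegIdx σ m) k) : polarizeLin m D F = polarize m D F :=
  rfl

/-- **Equivariance of the full polarisation** (linear-map form of `polarize_coordSubst`).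
[folklore] -/
theorem polarizeLin_coordSubst [CharZero k] (g : GL σ k) {F : MvPolynomial (DegIdx σ m) k}
    (hF : F.IsHomogeneous D) :
    polarizeLin m D (coordSubst m g F) = nestedAct g (polarizeLin m D F) := by
  funext u
  rw [polarizeLin_apply, polarize_coordSubst g hF u]
  rfl

/-- **The weight-`χ` part of a lifted semi-invariant class.** If `V(χ)` occurs in `k[Δ_m[f]]`
(`m ≠ 0`, `k` of characteristic zero), there is a form `P` of degree `D = |χ|/m` on `Sym^m`,
not in the ideal `I` of the orbit closure, with `b · P ≡ χ(b) P (mod I)` for all upper triangular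
`b`: lift a nonzero semi-invariant class (`exists_lift_of_hasHighestWeight_orbitCoordRep`) and
keep its monomials of torus weight `χ` (the other weight parts lie in `I`,
`sum_filter_monWeight_mem_orbitVanishingIdeal`; a torus weight pins the degree, BLMW 2011 §4.4).
[cite: BurgisserEtAl2011, §4.4 and §5.2] -/
theorem exists_semiInvariant_mod_orbitVanishingIdeal [CharZero k] (f : MvPolynomial σ k)
    (hm : m ≠ 0) {χ : Literature.NumberTheory.DiophantineGeometry.Weight σ} (h : Literature.NumberTheory.DiophantineGeometry.HasHighestWeight (orbitCoordRep f m) χ) :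
    ∃ P : MvPolynomial (DegIdx σ m) k, P.IsHomogeneous ((-χ.size).toNat / m) ∧
      P ∉ orbitVanishingIdeal f m ∧
      ∀ b : GL σ k, Literature.NumberTheory.DiophantineGeometry.IsUpperTriangular b →
        coordSubst m b P - Literature.NumberTheory.DiophantineGeometry.weightChar χ b • P ∈ orbitVanishingIdeal f m := by
  classical
  obtain ⟨F, hFI, hF⟩ := exists_lift_of_hasHighestWeight_orbitCoordRep f h
  -- the weight-`χ` part `P` of `F`; the other weight parts lie in the ideal
  obtain ⟨P, hP⟩ : ∃ P : MvPolynomial (DegIdx σ m) k,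
      P = ∑ s ∈ F.support.filter (fun s => monWeight s = χ), monomial s (coeff s F) := ⟨_, rfl⟩
  have hdiff : F - P ∈ orbitVanishingIdeal f m := by
    have hmaps : ∀ s ∈ F.support, monWeight s ∈ insert χ (F.support.image monWeight) :=
      fun s hs => Finset.mem_insert_of_mem (Finset.mem_image_of_mem _ hs)
    have hFsum : F = ∑ v ∈ insert χ (F.support.image monWeight),
        ∑ s ∈ F.support.filter (fun s => monWeight s = v), monomial s (coeff s F) := by
      conv_lhs => rw [← F.support_sum_monomial_coeff]
      exact (Finset.sum_fiberwise_of_maps_to hmaps _).symm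
    have hsplit : F - P = ∑ v ∈ (insert χ (F.support.image monWeight)).erase χ,
          ∑ s ∈ F.support.filter (fun s => monWeight s = v), monomial s (coeff s F) := by
      rw [sub_eq_iff_eq_add, hP, Finset.sum_erase_add _ _ (Finset.mem_insert_self χ _), ← hFsum]
    rw [hsplit]
    exact Ideal.sum_mem _ fun v hv =>
      Literature.NumberTheory.DiophantineGeometry.sum_filter_monWeight_mem_orbitVanishingIdeal f (fun t ht => hF t ht.isUpperTriangular)
        (Finset.ne_of_mem_erase hv)
  refine ⟨P, ?_, ?_, ?_⟩
  · -- a torus weight pins the degree (BLMW 2011 §4.4)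
    rw [hP]
    refine IsHomogeneous.sum _ _ _ fun s hs => ?_
    have hw := (Finset.mem_filter.mp hs).2
    have hsize := size_monWeight s
    rw [hw] at hsize
    have h1 : (-χ.size).toNat = m * s.degree := by rw [hsize, neg_neg, Int.toNat_natCast]
    have hdeg : s.degree = (-χ.size).toNat / m := by
      rw [h1, Nat.mul_div_cancel_left _ (Nat.pos_of_ne_zero hm)]
    rw [← hdeg]
    exact isHomogeneous_monomial _ (by rw [Finsupp.degree_eq_weight_one])
  · intro hmem
    apply hFI
    have := Ideal.add_mem _ hdiff hmem
    rwa [sub_add_cancel] at this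
  · intro b hb
    have h2 : coordSubst m b (F - P) - Literature.NumberTheory.DiophantineGeometry.weightChar χ b • (F - P) ∈ orbitVanishingIdeal f m :=
      Ideal.sub_mem _ (orbitVanishingIdeal_le_comap_coordSubst f m b hdiff)
        (Submodule.smul_of_tower_mem _ _ hdiff)
    have := Ideal.sub_mem _ (hF b hb) h2
    rwa [map_sub, smul_sub, show coordSubst m b F - Literature.NumberTheory.DiophantineGeometry.weightChar χ b • F -
      (coordSubst m b F - coordSubst m b P - (Literature.NumberTheory.DiophantineGeometry.weightChar χ b • F - Literature.NumberTheory.DiophantineGeometry.weightChar χ b • P)) =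
      coordSubst m b P - Literature.NumberTheory.DiophantineGeometry.weightChar χ b • P by abel] at this

/-- **`I(Δ_m[f]) ∩ k[Sym^m]_D` has a `GL`-stable complement after polarisation.** The image of
the degree-`D` part of the (stable) ideal of the orbit closure under the equivariant full
polarisation is stable under the nested kernel action, hence complemented by a stable subspace
(complete reducibility of tensor powers in characteristic zero,
`isSemisimpleRepresentation_glTensorRep`). BLMW 2011 §5.2.
[cite: EtingofEtAl2011, Thm. 4.57 (ii) and Prop. 4.58 (arXiv:0901.0827 numbering)] -/
theorem exists_isCompl_map_polarizeLin_orbitVanishingIdeal [CharZero k] (f : MvPolynomial σ k)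
    (m D : ℕ) :
    ∃ Y : Submodule k ((Fin D → Fin m → σ) → k),
      (∀ (g : GL σ k) (c : (Fin D → Fin m → σ) → k), c ∈ Y → nestedAct g c ∈ Y) ∧
      IsCompl ((homogeneousSubmodule (DegIdx σ m) k D ⊓
        (orbitVanishingIdeal f m).restrictScalars k).map (polarizeLin m D)) Y := by
  refine exists_isCompl_of_nestedAct_stable _ fun g c hc => ?_
  obtain ⟨G, hG, rfl⟩ := Submodule.mem_map.mp hc
  obtain ⟨hGM, hGI⟩ := Submodule.mem_inf.mp hG
  have hGhom : G.IsHomogeneous D := (mem_homogeneousSubmodule D G).mp hGM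
  refine Submodule.mem_map.mpr ⟨coordSubst m g G, Submodule.mem_inf.mpr
    ⟨(mem_homogeneousSubmodule D _).mpr (isHomogeneous_coordSubst g hGhom),
      orbitVanishingIdeal_le_comap_coordSubst f m g hGI⟩, ?_⟩
  exact polarizeLin_coordSubst g hGhom

/-- **From a semi-invariant modulo the ideal to an honest highest-weight vector.** If a form `P`
of degree `D` on `Sym^m (k^σ)` is not in the ideal `I` of `Δ_m[f]` and satisfies
`b · P ≡ χ(b) P (mod I)` for all upper triangular `b`, then `V(χ)` occurs in `k[Sym^m (k^σ)]`:
write `Φ(P) = Φ(A) + y` with `A ∈ I ∩ k[Sym^m]_D` and `y` in a stable complement of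
`Φ(I ∩ k[Sym^m]_D)` (`exists_isCompl_map_polarizeLin_orbitVanishingIdeal`); then `P - A ≠ 0`
and `b · (P - A) - χ(b)(P - A)` lies in `I ∩ k[Sym^m]_D` while its polarisation lies in the
complement, so it vanishes (`eq_of_polarize_eq`). BLMW 2011 §5.2 (`k[Δ[f]]_d` is a quotient
of the completely reducible `k[Sym^m]_d`). [cite: BurgisserEtAl2011, §5.2] -/
theorem hasHighestWeight_coordRep_of_semiInvariant_mod [CharZero k] (f : MvPolynomial σ k)
    {χ : Literature.NumberTheory.DiophantineGeometry.Weight σ} {P : MvPolynomial (DegIdx σ m) k} (hPhom : P.IsHomogeneous D)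
    (hPI : P ∉ orbitVanishingIdeal f m)
    (hPsemi : ∀ b : GL σ k, Literature.NumberTheory.DiophantineGeometry.IsUpperTriangular b →
      coordSubst m b P - Literature.NumberTheory.DiophantineGeometry.weightChar χ b • P ∈ orbitVanishingIdeal f m) :
    Literature.NumberTheory.DiophantineGeometry.HasHighestWeight (coordRep σ k m) χ := by
  obtain ⟨Y, hY, hcompl⟩ := exists_isCompl_map_polarizeLin_orbitVanishingIdeal (k := k) f m D
  -- decompose `Φ(P) = Φ(A) + y`
  have htop : polarizeLin m D P ∈ (homogeneousSubmodule (DegIdx σ m) k D ⊓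
      (orbitVanishingIdeal f m).restrictScalars k).map (polarizeLin m D) ⊔ Y := by
    rw [hcompl.sup_eq_top]; exact Submodule.mem_top
  obtain ⟨a, ha, y, hy, hay⟩ := Submodule.mem_sup.mp htop
  obtain ⟨A, hA, rfl⟩ := Submodule.mem_map.mp ha
  obtain ⟨hAM, hAI⟩ := Submodule.mem_inf.mp hA
  rw [Submodule.restrictScalars_mem] at hAI
  have hAhom : A.IsHomogeneous D := (mem_homogeneousSubmodule D A).mp hAM
  have hF'hom : (P - A).IsHomogeneous D := hPhom.sub hAhom
  have hF'y : polarizeLin m D (P - A) = y := by rw [map_sub, ← hay, add_sub_cancel_left]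
  refine (Literature.NumberTheory.DiophantineGeometry.hasHighestWeight_iff_exists _ _).mpr ⟨P - A, fun h0 => hPI ?_, fun b hb => ?_⟩
  · rw [sub_eq_zero.mp h0]
    exact hAI
  rw [coordRep_apply, ← sub_eq_zero]
  -- `G := b · F' - χ(b) F'` is a degree-`D` form in the ideal whose polarisation lies in `Y`
  have hGhom : (coordSubst m b (P - A) - Literature.NumberTheory.DiophantineGeometry.weightChar χ b • (P - A)).IsHomogeneous D :=
    (isHomogeneous_coordSubst b hF'hom).sub ((mem_homogeneousSubmodule D _).mp
      (Submodule.smul_mem _ _ ((mem_homogeneousSubmodule D _).mpr hF'hom)))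
  have hGI : coordSubst m b (P - A) - Literature.NumberTheory.DiophantineGeometry.weightChar χ b • (P - A) ∈ orbitVanishingIdeal f m := by
    have h2 : coordSubst m b A - Literature.NumberTheory.DiophantineGeometry.weightChar χ b • A ∈ orbitVanishingIdeal f m :=
      Ideal.sub_mem _ (orbitVanishingIdeal_le_comap_coordSubst f m b hAI)
        (Submodule.smul_of_tower_mem _ _ hAI)
    have := Ideal.sub_mem _ (hPsemi b hb) h2
    rwa [show coordSubst m b P - Literature.NumberTheory.DiophantineGeometry.weightChar χ b • P - (coordSubst m b A - Literature.NumberTheory.DiophantineGeometry.weightChar χ b • A) =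
      coordSubst m b (P - A) - Literature.NumberTheory.DiophantineGeometry.weightChar χ b • (P - A) by rw [map_sub, smul_sub]; abel] at this
  have hGX : polarizeLin m D (coordSubst m b (P - A) - Literature.NumberTheory.DiophantineGeometry.weightChar χ b • (P - A)) ∈
      (homogeneousSubmodule (DegIdx σ m) k D ⊓
        (orbitVanishingIdeal f m).restrictScalars k).map (polarizeLin m D) :=
    Submodule.mem_map.mpr ⟨_, Submodule.mem_inf.mpr ⟨(mem_homogeneousSubmodule D _).mpr hGhom,
      (Submodule.restrictScalars_mem _ _ _).mpr hGI⟩, rfl⟩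
  have hGY : polarizeLin m D (coordSubst m b (P - A) - Literature.NumberTheory.DiophantineGeometry.weightChar χ b • (P - A)) ∈ Y := by
    rw [map_sub, map_smul, polarizeLin_coordSubst b hF'hom, hF'y]
    exact Y.sub_mem (hY b y hy) (Y.smul_mem _ hy)
  have hG0 : polarizeLin m D (coordSubst m b (P - A) - Literature.NumberTheory.DiophantineGeometry.weightChar χ b • (P - A)) = 0 := by
    have := Submodule.mem_inf.mpr ⟨hGX, hGY⟩
    rwa [hcompl.inf_eq_bot, Submodule.mem_bot] at this
  refine eq_of_polarize_eq hGhom (isHomogeneous_zero _ _ _) ?_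
  rw [← polarizeLin_apply, ← polarizeLin_apply, hG0, map_zero]

/-- **The BLMW lift (discharge of `hasHighestWeight_coordRep_of_orbitCoordRep`).** In
characteristic zero, a highest weight occurring in the coordinate ring `k[Δ_m[f]]` of an orbit
closure occurs in `k[Sym^m (k^σ)]`: a nonzero semi-invariant class lifts to a form `P` of the
degree `D` pinned by `χ`, semi-invariant modulo the `GL`-stable ideal `I`
(`exists_semiInvariant_mod_orbitVanishingIdeal`); by the complete reducibility of
`(k^σ)^{⊗ mD}` (Schur–Weyl in characteristic zero, `isSemisimpleRepresentation_glTensorRep`)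
transported along the injective equivariant full polarisation
`Φ : k[Sym^m (k^σ)]_D ↪ (functions on nested words)` (`polarize_coordSubst`, `eq_of_polarize_eq`),
the stable subspace `Φ(I ∩ k[Sym^m]_D)` has a stable complement, and the component of `P` along
it is an honest highest-weight vector (`hasHighestWeight_coordRep_of_semiInvariant_mod`).
BLMW 2011 §4.4, §5.2 (`k[Δ[f]]_d` is a quotient of `k[Sym^m]_d`, both completely reducible);
BIP §1(a), §3(b). [cite: BurgisserEtAl2011, §5.2] -/
theorem hasHighestWeight_coordRep_of_orbitCoordRep_holds :
    Literature.NumberTheory.DiophantineGeometry.hasHighestWeight_coordRep_of_orbitCoordRep (k := k) (σ := σ) := by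
  intro _ f m hm _ χ h
  obtain ⟨P, hPhom, hPI, hPsemi⟩ := exists_semiInvariant_mod_orbitVanishingIdeal f hm h
  exact hasHighestWeight_coordRep_of_semiInvariant_mod f hPhom hPI hPsemi

end Lift

end Literature.Computability.AlgebraicComplexity
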